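import Summits.AtomisticToContinuum.FouriersLaw.Theorems.VanishingNoiseTransferNoiseLocalityStubResponseDensityNoisyDyson2
import Summits.AtomisticToContinuum.FouriersLaw.Theorems.OddSectorIrreversibilityResponseDensityResponseIdentity
import Summits.AtomisticToContinuum.FouriersLaw.Theorems.OddSectorIrreversibilityResponseDensityDetailedBalance

/-!
# Flip-noisy response density, step 4: the response identity for the resolvent kernels
(helpers for stub `stub_responseDensityNoisy`)

Helper file `--supports stmt-AtomisticToContinuum-11975` (crux `NoiseLocality`, route
`VanishingNoiseTransfer`, line `relative-flip-energy-transfer`, stub 1b `stub_responseDensityNoisy`),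
namespace `…NoiseLocality.StubResponseDensityNoisy.Dyson`.

The finite-time response identity of the sibling route (`pinnedChain_finite_time_response_identity`:
with baths at `T ± δ/2` and the Gibbs weight `e^{-H/T}` at the mean temperature,
`∫ e^{-H/T} P_t ψ dx - ∫ e^{-H/T} ψ dx = δ (γ/2T²) ∫₀ᵗ ∫ P_s ψ · e^{-H/T}(p_0² - p_{N-1}²) dx ds`)
averaged over an independent exponential time of rate `r` gives the **resolvent response identity**

  `∫ e^{-H/T} R_r ψ dx - ∫ e^{-H/T} ψ dx = δ (γ/2T²) r⁻¹ ∫ R_r ψ · e^{-H/T} (p_0² - p_{N-1}²) dx`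

(`resolvent_response_identity_of_contDiff` for `ψ ∈ C²`, `resolvent_response_identity` for continuous
`ψ`, both with `|ψ| ≤ C e^{ϑH}`): Fubini and `∫₀^∞ r e^{-rt} ∫₀ᵗ G = ∫₀^∞ e^{-rs} G(s) ds`; the bounds
are uniform in `t` (orbit bound of `…Dyson1`), so every rate `r > 0` is allowed. No definitions. -/

noncomputable section

open MeasureTheory ProbabilityTheory Filter Topology Set
open scoped NNReal ENNReal ContDiff

namespace Summit.AtomisticToContinuum.FouriersLaw.Theorems.NoiseLocality.StubResponseDensityNoisy.Dyson

open Literature.MathematicalPhysics.KineticTheory.HeatConduction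
open Literature.Probability.Process Literature.MathematicalPhysics.KineticTheory OscillatorChain

variable {N : ℕ}

section RRI

variable {ω₂ lam β γ : ℝ} (hω : 0 < ω₂) (hl : 0 < lam) (hβ : 0 < β) (hγ : 0 < γ) (hN : 0 < N)
  {T : ℝ} (hT : 0 < T) {ϑ : ℝ} (hϑ : 0 < ϑ) (hϑT : ϑ < 1 / (2 * T)) {δ : ℝ} (hδ : |δ| < T)
  {r : ℝ} (hr : 0 < r)
include hω hl hβ hγ hN hT hϑ hϑT hδ hr

/-- **The resolvent response identity for `C²` observables.** For the pinned chain with baths at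
`T ± δ/2` (`|δ| < T`), `ψ ∈ C²` with `|ψ| ≤ C e^{ϑH}` (`0 < ϑ < 1/(2T)`) and any rate `r > 0`:
`∫ e^{-H/T} R_r ψ dx - ∫ e^{-H/T} ψ dx = δ (γ/2T²) r⁻¹ ∫ R_r ψ · e^{-H/T} (p_0² - p_{N-1}²) dx`. -/
theorem resolvent_response_identity_of_contDiff {ψ : PhaseSpace N → ℝ} (hψ2 : ContDiff ℝ 2 ψ) {C : ℝ}
    (hψb : ∀ y, |ψ y| ≤ C * Real.exp (ϑ * (pinnedChain ω₂ lam β γ).hamiltonian N y)) :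
    (∫ x, Real.exp (-1 / T * (pinnedChain ω₂ lam β γ).hamiltonian N x) *
        ∫ y, ψ y ∂((pinnedChainSemigroup hω hl.le hβ.le hγ.le hN (bath_window hT hδ).1.le
          (bath_window hT hδ).2.2.1.le).resolventKernel r x)) -
      ∫ x, Real.exp (-1 / T * (pinnedChain ω₂ lam β γ).hamiltonian N x) * ψ x =
      δ * (γ / (2 * T ^ 2)) * r⁻¹ *
        ∫ x, (∫ y, ψ y ∂((pinnedChainSemigroup hω hl.le hβ.le hγ.le hN (bath_window hT hδ).1.le
          (bath_window hT hδ).2.2.1.le).resolventKernel r x)) *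
          (Real.exp (-1 / T * (pinnedChain ω₂ lam β γ).hamiltonian N x) *
            (x.2 ⟨0, hN⟩ ^ 2 - x.2 ⟨N - 1, by omega⟩ ^ 2)) := by
  obtain ⟨hL, hL', hR, hR', -, -⟩ := bath_window hT hδ
  set Pc := pinnedChain ω₂ lam β γ with hPc
  set Hm := Pc.hamiltonian N with hHm
  have hHc : Continuous Hm := pinnedChain_continuous_hamiltonian ω₂ lam β γ N
  set Sg := pinnedChainSemigroup hω hl.le hβ.le hγ.le hN hL.le hR.le with hSg
  set Rk := Sg.resolventKernel r with hRk
  haveI := isProbabilityMeasure_expMeasure hr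
  haveI : IsMarkovKernel Rk := Sg.isMarkovKernel_resolventKernel hr
  set ρ := expMeasure r with hρ
  have hϑ' : ϑ < 1 / max (T + δ / 2) (T - δ / 2) := theta_lt_inv_max hϑT hL hL' hR'
  have hθϑ : -1 / T + ϑ < 0 := neg_inv_add_lt_zero hT hϑ'
  have hC : 0 ≤ C := by
    have := (abs_nonneg _).trans (hψb 0)
    exact nonneg_of_mul_nonneg_left this (Real.exp_pos _)
  have hψc : Continuous ψ := hψ2.continuous
  -- weights
  set wT : PhaseSpace N → ℝ := fun x => Real.exp (-1 / T * Hm x) with hwT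
  set gm : PhaseSpace N → ℝ := fun x => x.2 ⟨0, hN⟩ ^ 2 - x.2 ⟨N - 1, by omega⟩ ^ 2 with hgm
  have hwTc : Continuous wT := Real.continuous_exp.comp (continuous_const.mul hHc)
  have hgmc : Continuous gm := (((continuous_apply _).comp continuous_snd).pow 2).sub
    (((continuous_apply _).comp continuous_snd).pow 2)
  have hWm : Measurable fun z => Real.exp (ϑ * Hm z) :=
    (Real.continuous_exp.comp (continuous_const.mul hHc)).measurable
  -- the uniform orbit bound and the resolvent drift
  obtain ⟨c, B, a, b, hc, hB, ha, hb, hunif⟩ :=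
    lintegral_exp_kernel_resolventKernel_le_unif hω hl hβ hγ hN hT hϑ hϑT hr
  obtain ⟨hPt, hRes⟩ := hunif (T + δ / 2) (T - δ / 2) hL hL' hR hR'
  -- forecasts: integrability and the uniform bound
  set Pψ : ℝ≥0 × PhaseSpace N → ℝ := fun p => ∫ y, ψ y ∂(Pc.transitionKernel N (T + δ / 2) (T - δ / 2) p.1 p.2)
    with hPψ
  have hPψm : Measurable Pψ := pinnedChain_measurable_integral_kernel_uncurry hω hl.le hβ.le hγ.le N _ _
    hψc.stronglyMeasurable
  set Cψ : ℝ := C * (c.toReal + 1) with hCψ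
  have hPψb : ∀ (t : ℝ≥0) (x : PhaseSpace N), |Pψ (t, x)| ≤ C * (c.toReal * Real.exp (ϑ * Hm x) + B.toReal) := by
    intro t x
    have h := (integrable_abs_integral_le_of_lintegral_le hWm (fun z => (Real.exp_pos _).le)
      (ENNReal.add_ne_top.2 ⟨ENNReal.mul_ne_top hc ENNReal.ofReal_ne_top, hB⟩) (hPt t x)
      hψc.aestronglyMeasurable hC hψb).2
    rwa [toReal_affine hc hB (Real.exp_pos _).le] at h
  have hRψI : ∀ x, Integrable ψ (Rk x) := fun x =>
    (integrable_abs_integral_le_of_lintegral_le hWm (fun z => (Real.exp_pos _).le)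
      (ENNReal.add_ne_top.2 ⟨ENNReal.mul_ne_top ha.ne_top ENNReal.ofReal_ne_top, hb⟩) (hRes x)
      hψc.aestronglyMeasurable hC hψb).1
  have hRψ_eq : ∀ x, ∫ y, ψ y ∂(Rk x) = ∫ t, Pψ (t.toNNReal, x) ∂ρ := fun x =>
    integral_resolventKernel_of_integrable Sg hr x hψc.stronglyMeasurable (hRψI x)
  -- the dominating function in `x`, integrable
  set D : PhaseSpace N → ℝ := fun x => C * (c.toReal * Real.exp (ϑ * Hm x) + B.toReal) *
    (Real.exp (-1 / T * Hm x) * (1 + x.2 ⟨0, hN⟩ ^ 2 + x.2 ⟨N - 1, by omega⟩ ^ 2)) with hD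
  have hDi : Integrable D := by
    have h1 := integrable_momentSq_mul_exp_mul_hamiltonian hω hl.le hβ.le γ hN hθϑ (N := N)
    have h2 := integrable_momentSq_mul_exp_mul_hamiltonian hω hl.le hβ.le γ hN (c := -1 / T)
      (by rw [neg_div]; exact neg_neg_of_pos (one_div_pos.2 hT)) (N := N)
    refine ((h1.const_mul (C * c.toReal)).add (h2.const_mul (C * B.toReal))).congr
      (Eventually.of_forall fun x => ?_)
    simp only [hD, Pi.add_apply]
    rw [show (-1 / T + ϑ) * Hm x = -1 / T * Hm x + ϑ * Hm x by ring, Real.exp_add]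
    ring
  have hD0 : ∀ x, 0 ≤ D x := fun x => by
    rw [hD]; dsimp only
    have := ENNReal.toReal_nonneg (a := c); have := ENNReal.toReal_nonneg (a := B); positivity
  -- pointwise domination of the two integrands
  have hdomA : ∀ (t : ℝ≥0) (x : PhaseSpace N), |wT x * Pψ (t, x)| ≤ D x := by
    intro t x
    rw [abs_mul, abs_of_pos (Real.exp_pos _), hD]; dsimp only
    have h1 := hPψb t x
    have hsq : (1 : ℝ) ≤ 1 + x.2 ⟨0, hN⟩ ^ 2 + x.2 ⟨N - 1, by omega⟩ ^ 2 := by nlinarith [sq_nonneg (x.2 ⟨0, hN⟩), sq_nonneg (x.2 ⟨N - 1, by omega⟩)]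
    have hw : 0 < Real.exp (-1 / T * Hm x) := Real.exp_pos _
    have h0 : 0 ≤ C * (c.toReal * Real.exp (ϑ * Hm x) + B.toReal) := by
      have := ENNReal.toReal_nonneg (a := c); have := ENNReal.toReal_nonneg (a := B); positivity
    calc Real.exp (-1 / T * Hm x) * |Pψ (t, x)| ≤ Real.exp (-1 / T * Hm x) * (C * (c.toReal * Real.exp (ϑ * Hm x) + B.toReal)) :=
          mul_le_mul_of_nonneg_left h1 hw.le
      _ = C * (c.toReal * Real.exp (ϑ * Hm x) + B.toReal) * (Real.exp (-1 / T * Hm x) * 1) := by ring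
      _ ≤ _ := by gcongr
  have hdomG : ∀ (t : ℝ≥0) (x : PhaseSpace N), |Pψ (t, x) * (wT x * gm x)| ≤ D x := by
    intro t x
    rw [abs_mul, abs_mul, abs_of_pos (Real.exp_pos _), hD]; dsimp only
    have h1 := hPψb t x
    have hp : |gm x| ≤ 1 + x.2 ⟨0, hN⟩ ^ 2 + x.2 ⟨N - 1, by omega⟩ ^ 2 := by
      rw [hgm]; dsimp only
      rw [abs_le]; constructor <;> nlinarith [sq_nonneg (x.2 ⟨0, hN⟩), sq_nonneg (x.2 ⟨N - 1, by omega⟩)]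
    have h0 : 0 ≤ C * (c.toReal * Real.exp (ϑ * Hm x) + B.toReal) := by
      have := ENNReal.toReal_nonneg (a := c); have := ENNReal.toReal_nonneg (a := B); positivity
    calc |Pψ (t, x)| * (Real.exp (-1 / T * Hm x) * |gm x|)
        ≤ C * (c.toReal * Real.exp (ϑ * Hm x) + B.toReal) * (Real.exp (-1 / T * Hm x) * (1 + x.2 ⟨0, hN⟩ ^ 2 + x.2 ⟨N - 1, by omega⟩ ^ 2)) :=
          mul_le_mul h1 (mul_le_mul_of_nonneg_left hp (Real.exp_pos _).le) (by positivity) h0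
      _ = _ := rfl
  -- the two time functions `A`, `G`, their measurability and bounds
  set A : ℝ → ℝ := fun t => ∫ x, wT x * Pψ (t.toNNReal, x) with hA
  set G : ℝ → ℝ := fun s => ∫ x, Pψ (s.toNNReal, x) * (wT x * gm x) with hG
  have hAim : Measurable fun p : ℝ × PhaseSpace N => wT p.2 * Pψ (p.1.toNNReal, p.2) :=
    (hwTc.measurable.comp measurable_snd).mul
      (hPψm.comp ((measurable_real_toNNReal.comp measurable_fst).prodMk measurable_snd))
  have hGim : Measurable fun p : ℝ × PhaseSpace N => Pψ (p.1.toNNReal, p.2) * (wT p.2 * gm p.2) :=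
    (hPψm.comp ((measurable_real_toNNReal.comp measurable_fst).prodMk measurable_snd)).mul
      ((hwTc.mul hgmc).measurable.comp measurable_snd)
  have hAm : Measurable A := (hAim.stronglyMeasurable.integral_prod_right' (ν := volume)).measurable
  have hGmeas : Measurable G := (hGim.stronglyMeasurable.integral_prod_right' (ν := volume)).measurable
  have hAxI : ∀ t : ℝ, Integrable (fun x => wT x * Pψ (t.toNNReal, x)) := fun t =>
    hDi.mono' (hAim.comp (measurable_const.prodMk measurable_id)).aestronglyMeasurable
      (Eventually.of_forall fun x => by rw [Real.norm_eq_abs]; exact hdomA _ x)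
  have hGxI : ∀ s : ℝ, Integrable (fun x => Pψ (s.toNNReal, x) * (wT x * gm x)) := fun s =>
    hDi.mono' (hGim.comp (measurable_const.prodMk measurable_id)).aestronglyMeasurable
      (Eventually.of_forall fun x => by rw [Real.norm_eq_abs]; exact hdomG _ x)
  set Dint : ℝ := ∫ x, D x with hDint
  have hAb : ∀ t, |A t| ≤ Dint := fun t => by
    rw [hA]; dsimp only
    calc |∫ x, wT x * Pψ (t.toNNReal, x)| ≤ ∫ x, |wT x * Pψ (t.toNNReal, x)| := abs_integral_le_integral_abs
      _ ≤ ∫ x, D x := integral_mono (hAxI t).abs hDi fun x => hdomA _ x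
  have hGb : ∀ s, |G s| ≤ Dint := fun s => by
    rw [hG]; dsimp only
    calc |∫ x, Pψ (s.toNNReal, x) * (wT x * gm x)| ≤ ∫ x, |Pψ (s.toNNReal, x) * (wT x * gm x)| :=
          abs_integral_le_integral_abs
      _ ≤ ∫ x, D x := integral_mono (hGxI s).abs hDi fun x => hdomG _ x
  -- (1) the finite-time identity, at the time `t⁺`
  have hfin : ∀ t : ℝ, A t - ∫ x, wT x * ψ x = δ * (γ / (2 * T ^ 2)) * ∫ s in (0 : ℝ)..(t.toNNReal : ℝ), G s := by
    intro t
    exact pinnedChain_finite_time_response_identity hω hl.le hβ.le hγ hN hT hL hR hϑ hϑ' hψ2 hψb t.toNNReal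
  -- (2) Fubini: `∫ A(t⁺) dρ = ∫ e^{-H/T} Rψ`, `∫ G(t⁺) dρ = ∫ Rψ e^{-H/T} g`
  have hprodA : Integrable (Function.uncurry fun (t : ℝ) (x : PhaseSpace N) => wT x * Pψ (t.toNNReal, x))
      (ρ.prod volume) :=
    (hDi.comp_snd ρ).mono' hAim.aestronglyMeasurable
      (Eventually.of_forall fun p => by rw [Real.norm_eq_abs]; exact hdomA _ p.2)
  have hprodG : Integrable (Function.uncurry fun (t : ℝ) (x : PhaseSpace N) => Pψ (t.toNNReal, x) * (wT x * gm x))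
      (ρ.prod volume) :=
    (hDi.comp_snd ρ).mono' hGim.aestronglyMeasurable
      (Eventually.of_forall fun p => by rw [Real.norm_eq_abs]; exact hdomG _ p.2)
  have hFubA : ∫ t, A t ∂ρ = ∫ x, wT x * ∫ y, ψ y ∂(Rk x) := by
    rw [hA]; dsimp only
    rw [integral_integral_swap hprodA]
    refine integral_congr_ae (Eventually.of_forall fun x => ?_)
    dsimp only
    rw [integral_const_mul, hRψ_eq x]
  have hFubG : ∫ t, G t ∂ρ = ∫ x, (∫ y, ψ y ∂(Rk x)) * (wT x * gm x) := by
    rw [hG]; dsimp only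
    rw [integral_integral_swap hprodG]
    refine integral_congr_ae (Eventually.of_forall fun x => ?_)
    dsimp only
    rw [integral_mul_const, hRψ_eq x]
  -- (3) the exponential average of `∫₀ᵗ G`
  have hexpG : ∫ t, (∫ s in (0 : ℝ)..(t.toNNReal : ℝ), G s) ∂ρ = r⁻¹ * ∫ t, G t ∂ρ := by
    rw [integral_expMeasure_eq_integral_Ioi hr, integral_expMeasure_eq_integral_Ioi hr]
    have h1 : EqOn (fun t : ℝ => r * Real.exp (-(r * t)) * ∫ s in (0 : ℝ)..(t.toNNReal : ℝ), G s)
        (fun t => r * Real.exp (-(r * t)) * ∫ s in (0 : ℝ)..t, G s) (Ioi 0) := fun t ht => by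
      simp only [Real.coe_toNNReal t (le_of_lt ht)]
    rw [setIntegral_congr_fun measurableSet_Ioi h1,
      integral_exp_mul_intervalIntegral_eq hGmeas (fun s => (Real.norm_eq_abs _).le.trans (hGb s)) hr,
      ← integral_const_mul]
    refine setIntegral_congr_fun measurableSet_Ioi fun t _ => ?_
    field_simp
  -- (4) assemble
  have hAI : Integrable A ρ := (integrable_const Dint).mono' hAm.aestronglyMeasurable
    (Eventually.of_forall fun t => by rw [Real.norm_eq_abs]; exact hAb t)
  have hint0 : ∫ t, (A t - ∫ x, wT x * ψ x) ∂ρ = (∫ t, A t ∂ρ) - ∫ x, wT x * ψ x := by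
    rw [integral_sub hAI (integrable_const _), integral_const, probReal_univ, one_smul]
  have key : (∫ t, A t ∂ρ) - ∫ x, wT x * ψ x = δ * (γ / (2 * T ^ 2)) * (r⁻¹ * ∫ t, G t ∂ρ) := by
    rw [← hint0, ← hexpG, ← integral_const_mul]
    exact integral_congr_ae (Eventually.of_forall hfin)
  rw [hFubA, hFubG] at key; rw [key]; ring

omit hγ hN hT hϑT hδ hr in
/-- **Smooth approximation of weighted continuous observables**: a continuous `F` with
`|F| ≤ C e^{ϑH}` is the pointwise limit of `C²` (indeed `C_c^∞`) functions `F_k` with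
`|F_k| ≤ (C + 1) e^{ϑH}` (energy cut-off, then `exists_contDiff_hasCompactSupport_abs_sub_le`). -/
theorem exists_contDiff_approx {F : PhaseSpace N → ℝ} (hF : Continuous F) {C : ℝ}
    (hFb : ∀ y, |F y| ≤ C * Real.exp (ϑ * (pinnedChain ω₂ lam β γ).hamiltonian N y)) :
    ∃ Fk : ℕ → PhaseSpace N → ℝ, (∀ k, ContDiff ℝ 2 (Fk k)) ∧
      (∀ k y, |Fk k y| ≤ (C + 1) * Real.exp (ϑ * (pinnedChain ω₂ lam β γ).hamiltonian N y)) ∧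
      ∀ y, Tendsto (fun k => Fk k y) atTop (𝓝 (F y)) := by
  set Hm := (pinnedChain ω₂ lam β γ).hamiltonian N with hHm
  have hHc : Continuous Hm := pinnedChain_continuous_hamiltonian ω₂ lam β γ N
  have hsc : Continuous smoothCutoff := (contDiff_smoothCutoff (n := 0)).continuous
  -- the truncations `χ(H/(k+1)) F` and their smooth approximations
  have hcut : ∀ k : ℕ, ∃ F' : PhaseSpace N → ℝ, ContDiff ℝ ∞ F' ∧
      ∀ y, |F' y - smoothCutoff (Hm y / (k + 1)) * F y| ≤ 1 / (k + 1) := by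
    intro k
    have hk : (0 : ℝ) < k + 1 := by positivity
    have hgc : Continuous fun y => smoothCutoff (Hm y / (k + 1)) * F y :=
      (hsc.comp (hHc.div_const _)).mul hF
    have hgs : HasCompactSupport fun y => smoothCutoff (Hm y / (k + 1)) * F y := by
      refine HasCompactSupport.intro (pinnedChain_isCompact_setOf_hamiltonian_le hω hl.le hβ.le γ N
        (2 * (k + 1))) fun y hy => ?_
      simp only [Set.mem_setOf_eq, not_le] at hy
      rw [smoothCutoff_of_two_le ((le_div_iff₀ hk).2 (by linarith)), zero_mul]
    obtain ⟨F', hF', -, hF'b⟩ := exists_contDiff_hasCompactSupport_abs_sub_le hgc hgs (one_div_pos.2 hk)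
    exact ⟨F', hF', hF'b⟩
  choose Fk hFk hFkb using hcut
  refine ⟨Fk, fun k => (hFk k).of_le (by norm_cast), fun k y => ?_, fun y => ?_⟩
  · have h1 := hFkb k y
    have hk : (0 : ℝ) < k + 1 := by positivity
    have h2 : |smoothCutoff (Hm y / (k + 1)) * F y| ≤ C * Real.exp (ϑ * Hm y) := by
      rw [abs_mul, abs_of_nonneg (smoothCutoff_nonneg _)]
      exact (mul_le_of_le_one_left (abs_nonneg _) (smoothCutoff_le_one _)).trans (hFb y)
    have h3 : 1 / ((k : ℝ) + 1) ≤ 1 := by rw [div_le_one hk]; linarith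
    have h4 : (1 : ℝ) ≤ Real.exp (ϑ * Hm y) :=
      Real.one_le_exp (mul_nonneg hϑ.le (pinnedChain_hamiltonian_nonneg hω.le hl.le hβ.le γ N y))
    have := abs_sub_abs_le_abs_sub (Fk k y) (smoothCutoff (Hm y / (k + 1)) * F y)
    nlinarith
  · -- eventually `χ(H(y)/(k+1)) = 1`, then `|F_k(y) - F(y)| ≤ 1/(k+1) → 0`
    rw [Metric.tendsto_atTop]
    intro ε hε
    obtain ⟨k₀, hk₀⟩ := exists_nat_gt (max (Hm y) (1 / ε))
    refine ⟨k₀, fun k hk => ?_⟩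
    have hk1 : (0 : ℝ) < k + 1 := by positivity
    have hkk : (k₀ : ℝ) ≤ k := by exact_mod_cast hk
    have hHy : Hm y / (k + 1) ≤ 1 := by
      rw [div_le_one hk1]; linarith [le_max_left (Hm y) (1 / ε)]
    have h := hFkb k y
    rw [smoothCutoff_of_le_one hHy, one_mul] at h
    rw [Real.dist_eq]
    refine h.trans_lt ?_
    rw [div_lt_iff₀ hk1]
    have : 1 / ε < k + 1 := by linarith [le_max_right (Hm y) (1 / ε)]
    calc (1 : ℝ) = 1 / ε * ε := by field_simp
      _ < (k + 1) * ε := mul_lt_mul_of_pos_right this hε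
      _ = ε * (k + 1) := by ring

/-- **The resolvent response identity for continuous weighted observables** (`|F| ≤ C e^{ϑH}`):
`∫ e^{-H/T} R_r F dx - ∫ e^{-H/T} F dx = δ (γ/2T²) r⁻¹ ∫ R_r F · e^{-H/T} (p_0² - p_{N-1}²) dx`
(the `C²` identity along the approximations of `exists_contDiff_approx`, dominated convergence). -/
theorem resolvent_response_identity {F : PhaseSpace N → ℝ} (hF : Continuous F) {C : ℝ}
    (hFb : ∀ y, |F y| ≤ C * Real.exp (ϑ * (pinnedChain ω₂ lam β γ).hamiltonian N y)) :
    (∫ x, Real.exp (-1 / T * (pinnedChain ω₂ lam β γ).hamiltonian N x) *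
        ∫ y, F y ∂((pinnedChainSemigroup hω hl.le hβ.le hγ.le hN (bath_window hT hδ).1.le
          (bath_window hT hδ).2.2.1.le).resolventKernel r x)) -
      ∫ x, Real.exp (-1 / T * (pinnedChain ω₂ lam β γ).hamiltonian N x) * F x =
      δ * (γ / (2 * T ^ 2)) * r⁻¹ *
        ∫ x, (∫ y, F y ∂((pinnedChainSemigroup hω hl.le hβ.le hγ.le hN (bath_window hT hδ).1.le
          (bath_window hT hδ).2.2.1.le).resolventKernel r x)) *
          (Real.exp (-1 / T * (pinnedChain ω₂ lam β γ).hamiltonian N x) *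
            (x.2 ⟨0, hN⟩ ^ 2 - x.2 ⟨N - 1, by omega⟩ ^ 2)) := by
  obtain ⟨hL, hL', hR, hR', -, -⟩ := bath_window hT hδ
  set Pc := pinnedChain ω₂ lam β γ with hPc
  set Hm := Pc.hamiltonian N with hHm
  have hHc : Continuous Hm := pinnedChain_continuous_hamiltonian ω₂ lam β γ N
  set Sg := pinnedChainSemigroup hω hl.le hβ.le hγ.le hN hL.le hR.le with hSg
  set Rk := Sg.resolventKernel r with hRk
  haveI : IsMarkovKernel Rk := Sg.isMarkovKernel_resolventKernel hr
  have hϑ' : ϑ < 1 / max (T + δ / 2) (T - δ / 2) := theta_lt_inv_max hϑT hL hL' hR'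
  have hθϑ : -1 / T + ϑ < 0 := neg_inv_add_lt_zero hT hϑ'
  have hC : 0 ≤ C := by
    have := (abs_nonneg _).trans (hFb 0)
    exact nonneg_of_mul_nonneg_left this (Real.exp_pos _)
  have hC1 : 0 ≤ C + 1 := by linarith
  obtain ⟨Fk, hFk2, hFkb, hFklim⟩ := exists_contDiff_approx hω hl hβ hϑ hF hFb
  have hWm : Measurable fun z => Real.exp (ϑ * Hm z) :=
    (Real.continuous_exp.comp (continuous_const.mul hHc)).measurable
  obtain ⟨_c, _B, a, b, _hc, _hB, ha, hb, hunif⟩ :=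
    lintegral_exp_kernel_resolventKernel_le_unif hω hl hβ hγ hN hT hϑ hϑT hr
  have hRes := (hunif (T + δ / 2) (T - δ / 2) hL hL' hR hR').2
  -- `R F_k → R F` pointwise, with the bound `|R F_k| ≤ (C+1)(a e^{ϑH} + b)`
  have hRI : ∀ {G : PhaseSpace N → ℝ}, Continuous G → ∀ {C' : ℝ}, 0 ≤ C' →
      (∀ y, |G y| ≤ C' * Real.exp (ϑ * Hm y)) → ∀ x, Integrable G (Rk x) ∧
        |∫ y, G y ∂(Rk x)| ≤ C' * (a.toReal * Real.exp (ϑ * Hm x) + b.toReal) := by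
    intro G hG C' hC' hGb x
    have h := integrable_abs_integral_le_of_lintegral_le hWm (fun z => (Real.exp_pos _).le)
      (ENNReal.add_ne_top.2 ⟨ENNReal.mul_ne_top ha.ne_top ENNReal.ofReal_ne_top, hb⟩) (hRes x)
      hG.aestronglyMeasurable hC' hGb
    rwa [toReal_affine ha.ne_top hb (Real.exp_pos _).le] at h
  have hRlim : ∀ x, Tendsto (fun k => ∫ y, Fk k y ∂(Rk x)) atTop (𝓝 (∫ y, F y ∂(Rk x))) := by
    intro x
    have hEi : Integrable (fun y => (C + 1) * Real.exp (ϑ * Hm y)) (Rk x) :=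
      (hRI (G := fun y => (C + 1) * Real.exp (ϑ * Hm y)) (by fun_prop) hC1 (fun y => by
        rw [abs_of_nonneg (by positivity)]) x).1
    exact tendsto_integral_of_dominated_convergence (fun y => (C + 1) * Real.exp (ϑ * Hm y))
      (fun k => (hFk2 k).continuous.aestronglyMeasurable) hEi
      (fun k => Eventually.of_forall fun y => by rw [Real.norm_eq_abs]; exact hFkb k y)
      (Eventually.of_forall fun y => hFklim y)
  -- the three dominated limits
  set wT : PhaseSpace N → ℝ := fun x => Real.exp (-1 / T * Hm x) with hwT
  set gm : PhaseSpace N → ℝ := fun x => x.2 ⟨0, hN⟩ ^ 2 - x.2 ⟨N - 1, by omega⟩ ^ 2 with hgm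
  have hwTc : Continuous wT := Real.continuous_exp.comp (continuous_const.mul hHc)
  have hgmc : Continuous gm := (((continuous_apply _).comp continuous_snd).pow 2).sub
    (((continuous_apply _).comp continuous_snd).pow 2)
  set D : PhaseSpace N → ℝ := fun x => (C + 1) * (a.toReal * Real.exp (ϑ * Hm x) + b.toReal) *
    (Real.exp (-1 / T * Hm x) * (1 + x.2 ⟨0, hN⟩ ^ 2 + x.2 ⟨N - 1, by omega⟩ ^ 2)) with hD
  have hDi : Integrable D := by
    have h1 := integrable_momentSq_mul_exp_mul_hamiltonian hω hl.le hβ.le γ hN hθϑ (N := N)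
    have h2 := integrable_momentSq_mul_exp_mul_hamiltonian hω hl.le hβ.le γ hN (c := -1 / T)
      (by rw [neg_div]; exact neg_neg_of_pos (one_div_pos.2 hT)) (N := N)
    refine ((h1.const_mul ((C + 1) * a.toReal)).add (h2.const_mul ((C + 1) * b.toReal))).congr
      (Eventually.of_forall fun x => ?_)
    simp only [hD, Pi.add_apply]
    rw [show (-1 / T + ϑ) * Hm x = -1 / T * Hm x + ϑ * Hm x by ring, Real.exp_add]
    ring
  have hsq : ∀ x : PhaseSpace N, (1 : ℝ) ≤ 1 + x.2 ⟨0, hN⟩ ^ 2 + x.2 ⟨N - 1, by omega⟩ ^ 2 := fun x => by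
    nlinarith [sq_nonneg (x.2 ⟨0, hN⟩), sq_nonneg (x.2 ⟨N - 1, by omega⟩)]
  have hgmb : ∀ x : PhaseSpace N, |gm x| ≤ 1 + x.2 ⟨0, hN⟩ ^ 2 + x.2 ⟨N - 1, by omega⟩ ^ 2 := fun x => by
    rw [hgm]; dsimp only
    rw [abs_le]; constructor <;> nlinarith [sq_nonneg (x.2 ⟨0, hN⟩), sq_nonneg (x.2 ⟨N - 1, by omega⟩)]
  have hab0 : ∀ x, 0 ≤ (C + 1) * (a.toReal * Real.exp (ϑ * Hm x) + b.toReal) := fun x => by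
    have := ENNReal.toReal_nonneg (a := a); have := ENNReal.toReal_nonneg (a := b); positivity
  -- measurability of `x ↦ R G (x)` for continuous `G`
  have hRm : ∀ {G : PhaseSpace N → ℝ}, Continuous G → Measurable fun x => ∫ y, G y ∂(Rk x) := fun hG =>
    (hG.stronglyMeasurable.integral_kernel (κ := Rk)).measurable
  -- (1) `∫ wT · R F_k → ∫ wT · R F`
  have hlim1 : Tendsto (fun k => ∫ x, wT x * ∫ y, Fk k y ∂(Rk x)) atTop
      (𝓝 (∫ x, wT x * ∫ y, F y ∂(Rk x))) := by
    refine tendsto_integral_of_dominated_convergence D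
      (fun k => (hwTc.measurable.mul (hRm (hFk2 k).continuous)).aestronglyMeasurable) hDi
      (fun k => Eventually.of_forall fun x => ?_) (Eventually.of_forall fun x => (hRlim x).const_mul _)
    rw [Real.norm_eq_abs, abs_mul, abs_of_pos (Real.exp_pos _), hD]; dsimp only
    calc Real.exp (-1 / T * Hm x) * |∫ y, Fk k y ∂(Rk x)|
        ≤ Real.exp (-1 / T * Hm x) * ((C + 1) * (a.toReal * Real.exp (ϑ * Hm x) + b.toReal)) :=
          mul_le_mul_of_nonneg_left (hRI (hFk2 k).continuous hC1 (hFkb k) x).2 (Real.exp_pos _).le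
      _ = (C + 1) * (a.toReal * Real.exp (ϑ * Hm x) + b.toReal) * (Real.exp (-1 / T * Hm x) * 1) := by ring
      _ ≤ _ := mul_le_mul_of_nonneg_left (mul_le_mul_of_nonneg_left (hsq x) (Real.exp_pos _).le) (hab0 x)
  -- (2) `∫ wT F_k → ∫ wT F`
  have hlim2 : Tendsto (fun k => ∫ x, wT x * Fk k x) atTop (𝓝 (∫ x, wT x * F x)) := by
    have h1 := integrable_exp_mul_hamiltonian hω hl.le hβ.le γ hθϑ (N := N)
    refine tendsto_integral_of_dominated_convergence (fun x => (C + 1) * Real.exp ((-1 / T + ϑ) * Hm x))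
      (fun k => (hwTc.mul (hFk2 k).continuous).aestronglyMeasurable) (h1.const_mul _)
      (fun k => Eventually.of_forall fun x => ?_) (Eventually.of_forall fun x => (hFklim x).const_mul _)
    rw [Real.norm_eq_abs, abs_mul, abs_of_pos (Real.exp_pos _),
      show (-1 / T + ϑ) * Hm x = -1 / T * Hm x + ϑ * Hm x by ring, Real.exp_add]
    calc Real.exp (-1 / T * Hm x) * |Fk k x| ≤ Real.exp (-1 / T * Hm x) * ((C + 1) * Real.exp (ϑ * Hm x)) :=
          mul_le_mul_of_nonneg_left (hFkb k x) (Real.exp_pos _).le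
      _ = _ := by ring
  -- (3) `∫ R F_k · wT g → ∫ R F · wT g`
  have hlim3 : Tendsto (fun k => ∫ x, (∫ y, Fk k y ∂(Rk x)) * (wT x * gm x)) atTop
      (𝓝 (∫ x, (∫ y, F y ∂(Rk x)) * (wT x * gm x))) := by
    refine tendsto_integral_of_dominated_convergence D
      (fun k => ((hRm (hFk2 k).continuous).mul (hwTc.mul hgmc).measurable).aestronglyMeasurable) hDi
      (fun k => Eventually.of_forall fun x => ?_) (Eventually.of_forall fun x => (hRlim x).mul_const _)
    rw [Real.norm_eq_abs, abs_mul, abs_mul, abs_of_pos (Real.exp_pos _), hD]; dsimp only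
    exact mul_le_mul (hRI (hFk2 k).continuous hC1 (hFkb k) x).2
      (mul_le_mul_of_nonneg_left (hgmb x) (Real.exp_pos _).le) (by positivity) (hab0 x)
  -- the identity along the sequence, and the limit
  have hk : ∀ k, (∫ x, wT x * ∫ y, Fk k y ∂(Rk x)) - ∫ x, wT x * Fk k x =
      δ * (γ / (2 * T ^ 2)) * r⁻¹ * ∫ x, (∫ y, Fk k y ∂(Rk x)) * (wT x * gm x) := fun k =>
    resolvent_response_identity_of_contDiff hω hl hβ hγ hN hT hϑ hϑT hδ hr (hFk2 k) (hFkb k)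
  exact tendsto_nhds_unique ((hlim1.sub hlim2).congr hk) (hlim3.const_mul (δ * (γ / (2 * T ^ 2)) * r⁻¹))

end RRI

/-- Registered helper sub-goal `helper_responseDensityNoisyDysonResolventResponse` of
stmt-AtomisticToContinuum-11975 (= `resolvent_response_identity`, fully quantified one-line form). -/
theorem helper_responseDensityNoisyDysonResolventResponse : ∀ (ω₂ lam β γ : ℝ) (hω : 0 < ω₂) (hl : 0 < lam) (hβ : 0 < β) (hγ : 0 < γ) (N : ℕ) (hN : 0 < N) (T : ℝ) (hT : 0 < T) (ϑ : ℝ), 0 < ϑ → ϑ < 1 / (2 * T) → ∀ (δ : ℝ) (hδ : |δ| < T) (r : ℝ), 0 < r → ∀ (F : Literature.MathematicalPhysics.KineticTheory.HeatConduction.PhaseSpace N → ℝ), Continuous F → ∀ (C : ℝ), (∀ y, |F y| ≤ C * Real.exp (ϑ * (Literature.MathematicalPhysics.KineticTheory.HeatConduction.pinnedChain ω₂ lam β γ).hamiltonian N y)) → (∫ x, Real.exp (-1 / T * (Literature.MathematicalPhysics.KineticTheory.HeatConduction.pinnedChain ω₂ lam β γ).hamiltonian N x) * ∫ y, F y ∂((Literature.MathematicalPhysics.KineticTheory.HeatConduction.pinnedChainSemigroup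 hω hl.le hβ.le hγ.le hN (Summit.AtomisticToContinuum.FouriersLaw.Theorems.NoiseLocality.StubResponseDensityNoisy.Dyson.bath_window hT hδ).1.le (Summit.AtomisticToContinuum.FouriersLaw.Theorems.NoiseLocality.StubResponseDensityNoisy.Dyson.bath_window hT hδ).2.2.1.le).resolventKernel r x)) - ∫ x, Real.exp (-1 / T * (Literature.MathematicalPhysics.KineticTheory.HeatConduction.pinnedChain ω₂ lam β γ).hamiltonian N x) * F x = δ * (γ / (2 * T ^ 2)) * r⁻¹ * ∫ x, (∫ y, F y ∂((Literature.MathematicalPhysics.KineticTheory.HeatConduction.pinnedChainSemigroup hω hl.le hβ.le hγ.le hN (Summit.AtomisticToContinuum.FouriersLaw.Theorems.NoiseLocality.StubResponseDensityNoisy.Dyson.bath_window hT hδ).1.le (Summit.AtomisticToContinuum.FouriersLaw.Theorems.NoiseLocality.StubResponseDensityNoisy.Dyson.bath_window hT hδ).2.2.1.le).resolventKernel r x)) * (Real.exp (-1 / T * (Literature.MathematicalPhysics.KineticTheory.HeatConduction.pinnedChain ω₂ lam β γ).hamiltonian N x) * (x.2 ⟨0, hN⟩ ^ 2 - x.2 ⟨N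 - 1, by omega⟩ ^ 2)) :=
  fun _ _ _ _ hω hl hβ hγ _ hN _ hT _ hϑ hϑT _ hδ _ hr _ hF _ hFb =>
    resolvent_response_identity hω hl hβ hγ hN hT hϑ hϑT hδ hr hF hFb

end Summit.AtomisticToContinuum.FouriersLaw.Theorems.NoiseLocality.StubResponseDensityNoisy.Dyson

end
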